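import Literature.MathematicalPhysics.QuantumFieldTheory.Balaban1983to89.B2Eq246PairStep
import Literature.MathematicalPhysics.QuantumFieldTheory.Balaban1983to89.B2Eq273NeumannLocality
import Literature.MathematicalPhysics.QuantumFieldTheory.Balaban1983to89.HiggsDoubleRT

/-!
# `Balaban1983to89.B2Eq246MaskedStep` — T. Bałaban, *(Higgs)₂,₃ quantum fields in a finite volume. II. An upper bound*,
Commun. Math. Phys. **86** (1982) 555–594 [Balaban1982Higgs2] p. 567: **(2.45) → (2.46) WITH PRINT'S MASKS AND PRINT'S KERNEL
FIELD** — the conditional integration *"with the conditioning on Λ₅^{(k−1)c}"* when the basic quadratic form of (2.45) is taken on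
the MASKED field `Λ₃^{(k−1)}φ′` (resp. `Λ₆^{(k−2)′}A′`) only, as printed, and the kernel `t^{L^{k−1}ε}_{a,L,Ã}` carries the field
`Ã = (1 − θ_k)θ_{k−1}A^{(k−1),ε} + θ_kA^{(k),ε}` while the form and the conditional covariance carry `A^{(k),ε}`, as printed;
FIBREWISE (at a fixed exterior field, no weight, no convergence hypothesis) and INTEGRATED against every NONNEGATIVE measurable
weight of the exterior field (no boundedness hypothesis) — removing HONEST SCOPE (a) of the typer's `B2Eq246ScalarStep` /
`B2Eq246PairStep` (*"the basic form is taken on all of T^{(j)} — the print restricts it to Λ₃^{(k−1)} ⊃ Λ₅^{(k−1)}"*)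

statement-level skeleton of published theorems with citation tags; proofs where landed; nothing here is a claim about the Yang–Mills mass gap

PDFs held: `paper:balaban1982-cmp86-higgs23-ii` (journal page = PDF page + 554), p. 567 [PDF 13] read AS AN IMAGE on the ×2 render
`run/shared/lean/pub/pub-balaban/b2b-balaban-ref1/pages/1982-cmp86-higgs23-II/1982-cmp86-higgs23-II-p013-x2.png` (the OCR layer
garbles both displays); part I [Balaban1982Higgs1] `paper:balaban1982-cmp85-higgs23-i` p. 608 [PDF 6] ((2.1)–(2.7)), p. 611 (2.32).

CITATION HEADER (lean-in-tree rule).  lit-balaban typed skeleton (HOME `run/shared/lean/pub/lit-balaban/`), reader/typer and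
fold-owner line r02 (unit `lit-balaban-r02`, gen 52); SKELETON row **B2.Eq2.44** ((2.44)–(2.52), owner r02, second reader r14),
members (2.45)/(2.46).  The owner's READING-RULE AUDIT (`HOME/lit-balaban-r02/READING-RULE-AUDIT-B2-g50.md` §6) found the
reading rule (a) failing for (2.45)/(2.46) only (*"the displays themselves … are not assembled"*) and named the owed member
`B2Eq245Assembled`; the gen-51 scoping note (HOME/HANDOFF § GEN 51) located the obstruction: *"the typer's `rt_condStep(_pair)`
use the basic form on ALL of T^{(j)}; print's (2.45) masks Λ₃^{(k−1)} (φ′) ∕ Λ₆^{(k−2)′} (A′) and the cross term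
⟨(Λ₃∩Λ₅ᶜ)φ′, ΔΛ₅φ′⟩ cannot be absorbed into the weight G(Λ₅ᶜφ′)"*.  THIS FILE is the masked step; the assembled displays are
the sequel `B2Eq245Assembled`.  NOTHING of record is restated: the fibre identity IS p15's `B2Eq234SecondRepr.integral_fiber`
(completion of the square + translation, model (2.34)) with the typer's dictionary `firstExp_eq_stepExp245` /
`secondExp_eq_stepExp246` / `mainOp_eq_formMat` / `norm_integrand_eq` / `rtKernelStep_eq` / `rtKernelOut_eq` / `kerQ_support` and
p15's `exp_firstExp` / `exp_secondExp`; the objects ARE the typer's `stepExp245`, `stepExp246`, `condTerms246`, `rtKernelOut`,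
`zCond252`, `fieldOfOut`, `fieldOfCrd`, `condCov232`, `condDelta227`, p35's `deltaKA` / `precOpA` / `avgQLin`, the kernel
`HiggsAveraging.rtKernelStep`; the contour geometry IS `B2Eq273NeumannLocality.stair_bond_inside` (p23/r14 lineage) and
`HiggsFluctMeasurePos.blockIter_surjective`.

THE SOURCE TEXT, p. 567 [PDF 13], verbatim (scalar-field lines; `A_{k−1} = A′`, `φ_{k−1} = φ′`):
*"ρ″^{(k),L^kε}(Λ₀^{(0)}, …, Λ₀^{(k−1)}, A, θ_kA^{(k),ε}, φ) = χ_k T^{L^{k−1}ε}_{a,L}[T^{L^{k−1}ε}_{a,L,Ã′}[ζ_{Λ₀^{(k−1)}}χ_{Λ₋₁^{(k−1)}∩Λ₅^{(k−1)c}}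
χ_{k−1,Λ₅^{(k−1)c}} · ρ′^{(k−1),L^{k−1}ε}(Λ₀^{(0)}, …, Λ₀^{(k−2)}, A′, Ã′, φ′) · exp[−½⟨Λ₆^{(k−2)′}A′, Δ^{(k−1),L^{k−1}ε}Λ₆^{(k−2)′}A′⟩ − …
− ½⟨Λ₃^{(k−1)}φ′, Δ^{(k−1),L^{k−1}ε}(B^{k−1}(Λ₂^{(k−1)}), A^{(k),ε})Λ₃^{(k−1)}φ′⟩]]], (2.45) where Ã = (1 − θ_k)θ_{k−1}A^{(k−1),ε} +
θ_kA^{(k),ε}, and the characteristic functions χ_k, ζ_{Λ₀^{(k−1)}}, etc. are defined analogously to the corresponding functions in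
Sect. A, with ε replaced by L^{k−1}ε and Λ₀ by Λ₀^{(k−1)}. Another representation is obtained by calculation of a conditional
integral in (2.45) with the conditioning on Λ₅^{(k−1)c}: ρ″^{(k),L^kε}(…) = χ_k∫dA′↾_{Λ₅^{(k−1)c}}∫dφ′↾_{Λ₅^{(k−1)c}}
t^{L^{k−1}ε}_{a,L}(Λ₅^{(k−1)c}; A, A′) t^{L^{k−1}ε}_{a,L,Ã}(Λ₅^{(k−1)c}; φ, φ′) · ζχχ ρ′^{(k−1),L^{k−1}ε}(…) · exp[… − ½⟨(Λ₃^{(k−1)}∩Λ₅^{(k−1)c})φ′,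
Δ^{(k−1),L^{k−1}ε}(B^{k−1}(Λ₂^{(k−1)}), A^{(k),ε})(Λ₃^{(k−1)}∩Λ₅^{(k−1)c})φ′⟩ + ½⟨(Λ₃^{(k−1)}∩Λ₅^{(k−1)c})φ′, Δ^{(k−1),L^{k−1}ε}(B^{k−1}(Λ₂^{(k−1)}),
A^{(k),ε}) C^{(k−1),L^{k−1}ε}_{Λ₅^{(k−1)}}(B^{k−1}(Λ₂^{(k−1)}), A^{(k),ε}) Δ^{(k−1),L^{k−1}ε}(B^{k−1}(Λ₂^{(k−1)}), A^{(k),ε})(Λ₃^{(k−1)}∩Λ₅^{(k−1)c})φ′⟩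
− a(L^kε)^{−2}⟨(Λ₃^{(k−1)}∩Λ₅^{(k−1)c})φ′, Δ^{(k−1),L^{k−1}ε}(B^{k−1}(Λ₂^{(k−1)}), A^{(k),ε}) C^{(k−1),L^{k−1}ε}_{Λ₅^{(k−1)}}(B^{k−1}(Λ₂^{(k−1)}), A^{(k),ε})
Q^*(A^{(k),ε})φ⟩ − ½⟨φ, Δ^{(k),L^kε}_{Λ₅^{(k−1)}}(B^{k−1}(Λ₂^{(k−1)}), A^{(k),ε})φ⟩] · Z^{(k−1),L^{k−1}ε}_{Λ₅^{(k−1)}} Z^{(k−1),L^{k−1}ε}_{Λ₅^{(k−1)}}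
(B^{k−1}(Λ₂^{(k−1)}), A^{(k),ε}). (2.46)"*; p. 566–567: *"The function θ_k is defined on T_η, is equal to 1 on B^{k−1}(Λ₂^{(k−1)}) and
varies “smoothly” from 1 to 0 on a slice of thickness < M surrounding B^{k−1}(Λ₂^{(k−1)})"*; part I p. 608 [PDF 6] (render
`…/1982-cmp85-higgs23-I/1982-cmp85-higgs23-I-p006-x2.png`): *"t^{L^kε}_{a,L,A}(Ω;ψ,φ) = Π_{y∈Ω′} t^{L^kε}_{a,L,A}(ψ(y), φ↾_{B(y)}), (2.5)"*,
*"t^{L^kε}_{a,L,A}(ψ(y), φ↾_{B(y)}) = (a(L^{k+1}ε)^{d−2}/2π)^{N/2} exp(−½a(L^{k+1}ε)^{d−2}|ψ(y) − (Q(A)φ)(y)|²), (2.6)"* and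
*"(Q(A)φ)(y) = L^{−d} Σ_{x∈B(y)} U(A(Γ_{y,x}))φ(x). (2.7)"* with the staircase contour Γ_{y,x} of (2.1) (the product (2.5), its
one-site Gaussian factor (2.6) and the block average (2.7) WITH its prefactor `L^{−d}` — `HiggsAveraging.avgQ` carries it — are three
displays; referee D-g74-1).

DICTIONARY (print ↦ Lean), as in the typer's files B/C: the step `k − 1 ↦ j` (new field `φ` ↦ `ψ : ScalarField P (j+1) N`,
fluctuation field `φ′` ↦ a field of level `j`), `Λ₅^{(k−1)}` ↦ `Λ = blockSet Λ′` for `Λ′ ⊂ T^{(j+1)}`, `(B^{k−1}(Λ₂^{(k−1)}), A^{(k),ε})`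
↦ the pair `(Ω, A)` of the form and of `C^{(j)}_Λ(Ω,A)`/`Δ^{(j+1)}_Λ(Ω,A)`, the kernel's field `Ã` ↦ `Ak`, the mask `Λ₃^{(k−1)}` ↦ a
set `M ⊇ Λ` of level-`j` sites, the exterior configuration `φ′↾_{Λ₅ᶜ}` ↦ `y : Out (inSet N Λ) → ℝ` (its field `fieldOfOut Λ y`), the
fluctuation field with prescribed parts ↦ `pairField Λ x y`, `(Λ₃∩Λ₅ᶜ)φ′` ↦ `cutTo M (fieldOfOut Λ y)` (= `fieldOfOut Λ (maskOut Λ M y)`),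
`θ_k = 1 on B^{k−1}(Λ₂^{(k−1)}) ⊇ B^{k−1}(Λ₅^{(k−1)})` ↦ the hypothesis `hAk`: `Ak b = A b` for every finest-lattice bond `b` with
both endpoints in one block `B^{j+1}(y)`, `y ∈ Λ′` (the bonds the contours `Γ_{y,x}`, `x ∈ B(y)`, run through).

WHAT THIS FILE PROVES (kernel-checked, 0 `sorry`, standard axioms; three definitions WITH BODY — `pairField`, `innerKernel`,
`maskOut` —, theorems otherwise; NO `Prop`-valued fact).
 §0 `pairField` (= `fieldOfCrd`/`fieldOfOut` on zero parts; cuts `cutTo_pairField`, `cutTo_compl_pairField`; measurable),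
    **`integral_eq_integral_pairField`** (`∫dφ′ = ∫d(φ′↾_Λ, φ′↾_{Λᶜ})`, no integrability needed).
 §1 **`integral_prod_symm_of_nonneg`** — iterated = joint integration for a nonnegative measurable integrand with integrable
    fibres and NO global integrability (both sides `0` when the total mass is infinite: `integrable_prod_iff'`).
 §2 **`fiber_condStep`** (`∫dφ′↾_Λ e^{stepExp245(ψ,(x,y))} = e^{stepExp246(ψ, y)} · ∫dφ′↾_Λ e^{−½⟨φ′,(C^{(j)}_Λ)^{−1}φ′⟩}`) and its kernel
    form **`fiber_rt_condStep`** (`∫dφ′↾_Λ t_{a,L,A}(ψ,φ′)e^{−½⟨φ′,Δφ′⟩} = t(Λᶜ;ψ,y)·e^{condTerms246(ψ,y)}·Z^{(j)}_Λ(Ω,A)`) — the typer's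
    `condStep246`/`rt_condStep` WITHOUT the exterior integration and without any weight.
 §3 locality of the kernel (2.5): `rtKernelStep_split` (`t = innerKernel · rtKernelOut`), `innerKernel_congr_field` (the inner
    blocks see `φ′↾_{B(Λ′)}`), `rtKernelOut_congr_field` (the outer blocks see `φ′↾_{B(Λ′)ᶜ}`), **`contourSum_congr_gauge`** /
    **`avgQ_congr_gauge`** (`A(Γ_{y,x})`, `x ∈ B(y)`, hence `(Q(A)φ)(y)`, depend on `A` on the bonds INSIDE `B^{j+1}(y)` only,
    `j + 1 ≤ K`), `innerKernel_congr_gauge`; positivity.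
 §4 `maskOut`, `fieldOfOut_maskOut`, **`cutTo_pairField_of_subset`** (`M(x, y) = (x, (M∩Λᶜ)y)` for `M ⊇ Λ`),
    `maskedIntegrand_mul_eq` (the masked/`Ã` integrand is the unmasked/`A` integrand at the masked exterior field times a
    fibre-constant ratio of exterior kernels) and **`fiber_rt_condStep_masked`**:
    `∫dφ′↾_Λ t_{a,L,Ã}(ψ,φ′)·e^{−½⟨Mφ′, Δ^{(j)}(Ω,A)Mφ′⟩} = t_Ã(Λᶜ;ψ,y) · e^{condTerms246(ψ,(M∩Λᶜ)y)} · Z^{(j)}_Λ(Ω,A)`.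
 §5 `integrable_fiber`, `integrable_fiber_masked`, `measurable_maskedIntegrand`, and **`rt_condStep_masked`**: for every
    NONNEGATIVE measurable weight `G`,
    `∫dφ′ t_{a,L,Ã}(ψ,φ′)·e^{−½⟨Mφ′,ΔMφ′⟩}·G(Λᶜφ′) = ∫dφ′↾_{Λᶜ} t_Ã(Λᶜ;ψ,φ′)·e^{condTerms246(ψ,(M∩Λᶜ)φ′)}·G(φ′↾_{Λᶜ}) · Z^{(j)}_Λ(Ω,A)`
    — terms 7–10 of (2.46) with the exterior field decorated `(Λ₃^{(k−1)}∩Λ₅^{(k−1)c})φ′` EXACTLY AS PRINTED.  The vector-field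
    lines 1–4 of (2.46) are the same theorem at `N = d`, `zeroCharge`, `Ak = A = 0`, `Ω = T` (`B2Eq246PairStep` §1), mask
    `Λ₆^{(k−2)′}`.
HONEST SCOPE.  (a) `M` is any finite set of level-`j` sites containing `B(Λ′)` and `Λ′` any finite set of level-`(j+1)` sites
(print: Λ₃^{(k−1)} ⊃ Λ₅^{(k−1)}, unions of large blocks); (b) the agreement hypothesis `hAk` is what print's «θ_k = 1 on
B^{k−1}(Λ₂^{(k−1)})» delivers for `Λ₅^{(k−1)} ⊂ Λ₂^{(k−1)}` — this file does not construct `θ_k`, `Ã` (r14's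
`B2Sect2BDensities.aTilde245`, the typer's `B2Eq245Theta.thetaOf`); `j + 1 ≤ K` (print: `k ≤ K`) so that the blocks do not
wrap; (c) with a mask the left integral of §5 need not converge for a bounded weight (the directions of `φ′` outside `M` carry no
Gaussian) — the identity is stated for NONNEGATIVE weights: when the left integrand is integrable both sides are its (finite)
integral, and when it is not BOTH BOCHNER SIDES ARE `0` (Mathlib's convention for a divergent Bochner integral; §1
`integral_prod_symm_of_nonneg` via `integrable_prod_iff'`) — print's weight `ζχχρ′·exp[…]` is nonnegative and supplies the
convergence through `ρ′`; (d) `m² > 0`, `a > 0`, `L > 1` as in the typer's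
files; (e) nothing quantitative; the regions, cut-offs and `ρ′` are not constructed here (the sequel assembles the displays).
Value = the k-th step conditional integration certified in print's own masked / two-field form for the concrete objects;
NOT summit progress.  Unit `lit-balaban-r02` gen 52 (literature-prover-lit-balaban-r02-g52-0); HOME/FILED.md records the proposal;
doc-only revision folding referee ref-4's D-g74-1 (part-I displays (2.5)/(2.6)/(2.7) quoted separately, `L^{−d}` restored; HONEST
SCOPE (c) worded by the Bochner convention) — declarations and proofs byte-identical to commit c059f9ff3a90.
-/

open scoped BigOperators InnerProductSpace Matrix
open _root_.MeasureTheory Matrix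

namespace Literature.MathematicalPhysics.QuantumFieldTheory.Balaban1983to89.B2Eq246MaskedStep

open HiggsLattice HiggsAveraging HiggsCovariance B1Eq27StepAdjoint B1Eq221Coordinates B1Eq230FluctCov B1Eq230FluctCovPos
  HiggsCondCov232 HiggsCondGauss228 B2Eq255Concrete B2Eq227CondDelta B2Eq246ScalarStep
open B2Eq228Conditioning (In Out resIn resOut glue blkIn blkMix blkOut weight source secConst integral_section
  integrable_section_const)
open B2Eq234Exponent (mainOp firstExp secondExp exp_firstExp)
open B2Eq234SecondRepr (integral_fiber exp_secondExp)
open B13GaugeDevices (gaussWeight gaussNorm)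

variable {P : HiggsLattice.Params} {N : ℕ}

/-! ## §0 The field with prescribed parts on `Λ` and on `Λᶜ`; splitting the field integral -/

section PairField

variable {j : ℕ}

/-- **The field `φ′ = (x on Λ₅, y on Λ₅ᶜ)`**: inverse (1.5)-coordinates of p15's `glue x y` — the variable pair of the
conditional integration *"with the conditioning on Λ₅^{(k−1)c}"* (inner part `x` integrated, exterior part `y` kept).
[cite: Balaban1982Higgs2, (2.46) p.567] -/
noncomputable def pairField (Λ : Finset (HiggsLattice.Site P j)) (x : In (inSet (P := P) N Λ) → ℝ)
    (y : Out (inSet (P := P) N Λ) → ℝ) : ScalarField P j N :=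
  (fieldCoord (E N) (HiggsLattice.Site P j)).symm (glue (inSet N Λ) x y)

/-- `fieldCoord (pairField Λ x y) = glue x y`. [cite: Balaban1982Higgs2, (2.46) p.567] -/
theorem fieldCoord_pairField (Λ : Finset (HiggsLattice.Site P j)) (x : In (inSet (P := P) N Λ) → ℝ)
    (y : Out (inSet (P := P) N Λ) → ℝ) :
    fieldCoord (E N) (HiggsLattice.Site P j) (pairField Λ x y) = glue (inSet N Λ) x y :=
  LinearEquiv.apply_symm_apply _ _

/-- Exterior part `0`: `pairField Λ x 0` is the typer's `fieldOfCrd Λ x` (the `Λ`-configuration extended by zero).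
[cite: Balaban1982Higgs2, (2.46) p.567] -/
theorem pairField_zero_right (Λ : Finset (HiggsLattice.Site P j)) (x : In (inSet (P := P) N Λ) → ℝ) :
    pairField Λ x 0 = fieldOfCrd Λ x := rfl

/-- Inner part `0`: `pairField Λ 0 y` is the typer's `fieldOfOut Λ y` (the exterior configuration as a field).
[cite: Balaban1982Higgs2, (2.46) p.567] -/
theorem pairField_zero_left (Λ : Finset (HiggsLattice.Site P j)) (y : Out (inSet (P := P) N Λ) → ℝ) :
    pairField Λ 0 y = fieldOfOut Λ y := rfl

/-- `Λᶜ(pairField Λ x y) = fieldOfOut Λ y`: the exterior cut sees `y` only. [cite: Balaban1982Higgs2, (2.46) p.567] -/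
theorem cutTo_compl_pairField (Λ : Finset (HiggsLattice.Site P j)) (x : In (inSet (P := P) N Λ) → ℝ)
    (y : Out (inSet (P := P) N Λ) → ℝ) : cutTo Λᶜ (pairField Λ x y) = fieldOfOut Λ y := by
  rw [← fieldOfOut_resOut Λ (pairField Λ x y), fieldCoord_pairField, B2Eq228Conditioning.resOut_glue]

/-- `Λ(pairField Λ x y) = fieldOfCrd Λ x`: the inner cut sees `x` only. [cite: Balaban1982Higgs2, (2.46) p.567] -/
theorem cutTo_pairField (Λ : Finset (HiggsLattice.Site P j)) (x : In (inSet (P := P) N Λ) → ℝ)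
    (y : Out (inSet (P := P) N Λ) → ℝ) : cutTo Λ (pairField Λ x y) = fieldOfCrd Λ x := by
  rw [← fieldOfCrd_resIn Λ (pairField Λ x y), fieldCoord_pairField, B2Eq228Conditioning.resIn_glue]

/-- On `Λ` the pair field is `fieldOfCrd Λ x`. [cite: Balaban1982Higgs2, (2.46) p.567] -/
theorem pairField_apply_of_mem (Λ : Finset (HiggsLattice.Site P j)) (x : In (inSet (P := P) N Λ) → ℝ)
    (y : Out (inSet (P := P) N Λ) → ℝ) {s : HiggsLattice.Site P j} (hs : s ∈ Λ) :
    pairField Λ x y s = fieldOfCrd Λ x s := by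
  rw [← cutTo_pairField Λ x y, cutTo_of_mem Λ _ hs]

/-- Off `Λ` the pair field is `fieldOfOut Λ y`. [cite: Balaban1982Higgs2, (2.46) p.567] -/
theorem pairField_apply_of_not_mem (Λ : Finset (HiggsLattice.Site P j)) (x : In (inSet (P := P) N Λ) → ℝ)
    (y : Out (inSet (P := P) N Λ) → ℝ) {s : HiggsLattice.Site P j} (hs : s ∉ Λ) :
    pairField Λ x y s = fieldOfOut Λ y s := by
  rw [← cutTo_compl_pairField Λ x y, cutTo_of_mem Λᶜ _ (Finset.mem_compl.mpr hs)]

/-- `(x, y) ↦ pairField Λ x y` is jointly measurable (p34's measurable coordinates, p15's `measurable_glue`).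
[folklore] [cite: Balaban1982Higgs2, (2.28) p.563] -/
theorem measurable_pairField (Λ : Finset (HiggsLattice.Site P j)) :
    Measurable (fun q : (In (inSet (P := P) N Λ) → ℝ) × (Out (inSet (P := P) N Λ) → ℝ) => pairField Λ q.1 q.2) := by
  have h : (fun q : (In (inSet (P := P) N Λ) → ℝ) × (Out (inSet (P := P) N Λ) → ℝ) => pairField Λ q.1 q.2)
      = fun q => (fieldCoordM (E N) (HiggsLattice.Site P j)).symm (glue (inSet N Λ) q.1 q.2) := by
    funext q
    rw [fieldCoordM_symm_apply]
    rfl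
  rw [h]
  exact (fieldCoordM (E N) (HiggsLattice.Site P j)).symm.measurable.comp (B2Eq228Conditioning.measurable_glue _)

/-- **`∫dφ′ = ∫d(φ′↾_Λ, φ′↾_{Λᶜ})`**: the field integral as the integral over pairs (p34's change of variables
`integral_comp_fieldCoord` + p15's `integral_eq_integral_glue`; no integrability needed). [cite: Balaban1982Higgs2, (2.46) p.567] -/
theorem integral_eq_integral_pairField (Λ : Finset (HiggsLattice.Site P j)) (F : ScalarField P j N → ℝ) :
    ∫ φ, F φ = ∫ q : (In (inSet (P := P) N Λ) → ℝ) × (Out (inSet (P := P) N Λ) → ℝ), F (pairField Λ q.1 q.2) := by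
  rw [integral_comp_fieldCoord (E N) (HiggsLattice.Site P j),
    B2Eq228Conditioning.integral_eq_integral_glue (inSet (P := P) N Λ)]
  rfl

end PairField

/-! ## §1 Iterated integration of a NONNEGATIVE integrand with integrable fibres (no global integrability) -/

/-- **Tonelli in Bochner form for a nonnegative integrand whose fibres are all integrable**: `∫f d(μ×ν) = ∫dν(y) ∫dμ(x) f(x,y)`
with NO integrability hypothesis on `f` — if `f` is integrable this is Fubini; if not, the left side is `0` by convention and
so is the right side, because `y ↦ ∫f(x,y)dμ(x) = ∫‖f(x,y)‖dμ(x)` is then not integrable (`integrable_prod_iff'`).  This is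
the reading under which the masked conditional integration (2.45) = (2.46) holds for every nonnegative weight: both sides
are the (finite) integral when the integrand is integrable, and both Bochner sides are `0` when it is not. [folklore]
[cite: Balaban1982Higgs2, (2.46) p.567] -/
theorem integral_prod_symm_of_nonneg {X Y : Type*} [MeasurableSpace X] [MeasurableSpace Y] {μ : Measure X}
    {ν : Measure Y} [SigmaFinite μ] [SigmaFinite ν] {f : X × Y → ℝ} (hf : Measurable f) (h0 : ∀ q, 0 ≤ f q)
    (hfib : ∀ y, Integrable (fun x => f (x, y)) μ) :
    ∫ q, f q ∂(μ.prod ν) = ∫ y, ∫ x, f (x, y) ∂μ ∂ν := by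
  by_cases hint : Integrable f (μ.prod ν)
  · exact integral_prod_symm f hint
  · rw [integral_undef hint]
    have hns : ¬ Integrable (fun y => ∫ x, f (x, y) ∂μ) ν := by
      intro hI
      apply hint
      rw [integrable_prod_iff' hf.aestronglyMeasurable]
      refine ⟨Filter.Eventually.of_forall hfib, ?_⟩
      refine hI.congr (Filter.Eventually.of_forall fun y => ?_)
      refine integral_congr_ae (Filter.Eventually.of_forall fun x => ?_)
      beta_reduce
      rw [Real.norm_of_nonneg (h0 _)]
    rw [integral_undef hns]


/-! ## §2 The conditional step (2.45) → (2.46) FIBREWISE: the `Λ`-integral at a fixed exterior field -/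

section Fiber

variable (C : ChargeData N) (Ω : Finset (HiggsLattice.Site P 0)) (A : HiggsLattice.VecField P 0) (msq a : ℝ)

/-- **The fibre of the scalar conditional step**: at a fixed exterior configuration `y = φ′↾_{Λᶜ}` (`Λ = B(Λ′)`),
`∫dφ′↾_Λ exp(stepExp245(ψ, (φ′↾_Λ, y))) = exp(stepExp246(ψ, y)) · ∫dφ′↾_Λ exp(−½⟨φ′, (a(L^{j+1}ε)^{−2}P(A) + Δ^{(j)}(Ω,A))φ′⟩)`
— p15's `integral_fiber` (completion of the square + translation) with the typer's dictionary; no weight, no convergence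
hypothesis (the fibre is a Gaussian integral). [cite: Balaban1982Higgs2, (2.46) p.567] -/
theorem fiber_condStep {msq a : ℝ} (hmsq : 0 < msq) (ha : 0 < a) (hL : 1 < (P.L : ℝ)) {j : ℕ} (hj : j ≤ P.K)
    (Λ' : Finset (HiggsLattice.Site P (j + 1))) (ψ : ScalarField P (j + 1) N)
    (y : Out (inSet (P := P) N (blockSet Λ')) → ℝ) :
    ∫ x : In (inSet (P := P) N (blockSet Λ')) → ℝ, Real.exp (stepExp245 C Ω A msq a j ψ (pairField (blockSet Λ') x y))
      = Real.exp (stepExp246 C Ω A msq a j Λ' ψ (fieldOfOut (blockSet Λ') y))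
        * ∫ x : In (inSet (P := P) N (blockSet Λ')) → ℝ,
            Real.exp (-(1 / 2 : ℝ) * siteInner (fieldOfCrd (blockSet Λ') x)
              (precOpA C Ω A msq a j (fieldOfCrd (blockSet Λ') x))) := by
  have hA : (mainOp (B1RT.prec a (P.mesh (j + 1)) P.d) (kerQ C A j) (matD C A Ω msq a j)).PosDef := by
    rw [mainOp_eq_formMat]
    exact formMat_posDef C Ω A hmsq ha hL hj
  have hQ : ∀ s t, kerQ C A j s t ≠ 0 → (inSet N (blockSet Λ') s ↔ inSet N Λ' t) :=
    fun s t h => kerQ_support C A j Λ' s t h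
  have hst : ∀ i o, (i, o) ∉ (Finset.univ : Finset (In (inSet (P := P) N (blockSet Λ')) × Out (inSet (P := P) N (blockSet Λ'))))
      → blkMix (inSet N (blockSet Λ')) (matD C A Ω msq a j) i o = 0 := fun i o h => absurd (Finset.mem_univ _) h
  -- the integrand as p15's weight × source × constant
  have h1 : ∀ x : In (inSet (P := P) N (blockSet Λ')) → ℝ,
      Real.exp (stepExp245 C Ω A msq a j ψ (pairField (blockSet Λ') x y))
        = weight (mainOp (B1RT.prec a (P.mesh (j + 1)) P.d) (kerQ C A j) (matD C A Ω msq a j))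
            (glue (inSet N (blockSet Λ')) x y)
          * (source (B1RT.prec a (P.mesh (j + 1)) P.d • (kerQ C A j *ᵥ fieldCoord (E N) (HiggsLattice.Site P (j + 1)) ψ))
              (glue (inSet N (blockSet Λ')) x y)
            * Real.exp (-(1 / 2 : ℝ) * B1RT.prec a (P.mesh (j + 1)) P.d
                * ∑ t, fieldCoord (E N) (HiggsLattice.Site P (j + 1)) ψ t ^ 2)) := by
    intro x
    rw [← firstExp_eq_stepExp245 C Ω A msq a ψ (pairField (blockSet Λ') x y), fieldCoord_pairField, exp_firstExp]
    ring
  simp_rw [h1]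
  rw [integral_fiber (inSet N (blockSet Λ')) _ _ hA y,
    ← exp_secondExp (inSet N (blockSet Λ')) (inSet N Λ') _ _ _ hA hQ Finset.univ hst,
    secondExp_eq_stepExp246 C Ω A j hmsq ha hL hj, gaussNorm, mul_comm]
  congr 1
  refine integral_congr_ae (Filter.Eventually.of_forall fun x => ?_)
  beta_reduce
  rw [gaussWeight, mainOp_eq_formMat, norm_integrand_eq]
  congr 1
  ring

/-- The exponents bookkeeping: `|T^{(j+1)}| = |Λ′ᶜ| + |Λ′|`. [folklore] [cite: Balaban1982Higgs2, (2.46) p.567] -/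
theorem card_compl_add_card {j : ℕ} (Λ' : Finset (HiggsLattice.Site P (j + 1))) :
    ((Λ'ᶜ.card : ℕ) : ℝ) + (Λ'.card : ℝ) = (Fintype.card (HiggsLattice.Site P (j + 1)) : ℝ) := by
  rw [Finset.card_compl]
  have hle : Λ'.card ≤ Fintype.card (HiggsLattice.Site P (j + 1)) := Finset.card_le_univ _
  push_cast [Nat.cast_sub hle]
  ring

/-- **The fibre in the kernel form of the print**: at a fixed exterior configuration `y`,
`∫dφ′↾_Λ t^{L^jε}_{a,L,A}(ψ, φ′) exp(−½⟨φ′, Δ^{(j)}(Ω,A)φ′⟩) = t(Λᶜ; ψ, y) · exp(condTerms246(ψ, y)) · Z^{(j)}_Λ(Ω,A)`,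
`φ′ = (φ′↾_Λ, y)` — the typer's `rt_condStep` without the exterior integration. [cite: Balaban1982Higgs2, (2.46) p.567] -/
theorem fiber_rt_condStep {msq a : ℝ} (hmsq : 0 < msq) (ha : 0 < a) (hL : 1 < (P.L : ℝ)) {j : ℕ} (hj : j ≤ P.K)
    (Λ' : Finset (HiggsLattice.Site P (j + 1))) (ψ : ScalarField P (j + 1) N)
    (y : Out (inSet (P := P) N (blockSet Λ')) → ℝ) :
    ∫ x : In (inSet (P := P) N (blockSet Λ')) → ℝ,
        rtKernelStep C a A ψ (pairField (blockSet Λ') x y)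
          * Real.exp (-(1 / 2 : ℝ) * siteInner (pairField (blockSet Λ') x y)
              (deltaKA C Ω A msq a j (pairField (blockSet Λ') x y)))
      = rtKernelOut C A a j Λ' ψ (fieldOfOut (blockSet Λ') y)
          * Real.exp (condTerms246 C Ω A msq a j Λ' ψ (fieldOfOut (blockSet Λ') y))
          * zCond252 C Ω A msq a j Λ' := by
  set c : ℝ := B1RT.prec a (P.mesh (j + 1)) P.d / (2 * Real.pi) with hc_def
  have hprec : 0 < B1RT.prec a (P.mesh (j + 1)) P.d := B1RT.prec_pos ha (P.mesh_pos _) P.d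
  have hc : 0 < c := by rw [hc_def]; positivity
  have hL1 : (∫ x : In (inSet (P := P) N (blockSet Λ')) → ℝ,
        rtKernelStep C a A ψ (pairField (blockSet Λ') x y)
          * Real.exp (-(1 / 2 : ℝ) * siteInner (pairField (blockSet Λ') x y)
              (deltaKA C Ω A msq a j (pairField (blockSet Λ') x y))))
      = c ^ ((N : ℝ) / 2 * (Fintype.card (HiggsLattice.Site P (j + 1)) : ℝ))
          * ∫ x : In (inSet (P := P) N (blockSet Λ')) → ℝ,
              Real.exp (stepExp245 C Ω A msq a j ψ (pairField (blockSet Λ') x y)) := by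
    rw [← integral_const_mul]
    refine integral_congr_ae (Filter.Eventually.of_forall fun x => ?_)
    beta_reduce
    rw [rtKernelStep_eq C A j ψ _ ha, exp_stepExp245, ← hc_def]
    ring
  rw [hL1, fiber_condStep C Ω A hmsq ha hL hj Λ' ψ y,
    rtKernelOut_eq C A j Λ' ψ (cutTo_compl_fieldOfOut (blockSet Λ') y) ha, exp_stepExp246, zCond252, ← hc_def,
    ← card_compl_add_card Λ', mul_add, Real.rpow_def_of_pos hc, Real.rpow_def_of_pos hc, Real.rpow_def_of_pos hc,
    mul_add, Real.exp_add]
  ring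

end Fiber


/-! ## §3 Locality of the kernel (2.5): the blocks inside `Λ′` see `φ′↾_{B(Λ′)}` and the gauge field inside `B^{j+1}(Λ′)` only -/

section Kernel

variable (C : ChargeData N) (A : HiggsLattice.VecField P 0) (a : ℝ)

/-- **The inner factor of the kernel (2.5)**: the product of the one-site kernels (2.6) over the blocks `y ∈ Λ′`,
`Π_{y∈Λ′} (κ/2π)^{N/2} exp(−½κ|ψ(y) − (Q(A)φ)(y)|²)`, `κ = a(L^{j+1}ε)^{d−2}` — the part of `t^{L^jε}_{a,L,A}(ψ, φ)` integrated
by the conditional integration over `φ↾_{B(Λ′)}`; its complement is the typer's `rtKernelOut` = print's `t(Λ₅ᶜ; ·, ·)`.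
[cite: Balaban1982Higgs1, (2.5)–(2.6) p.608] [cite: Balaban1982Higgs2, (2.46) p.567] -/
noncomputable def innerKernel (j : ℕ) (Λ' : Finset (HiggsLattice.Site P (j + 1))) (ψ : ScalarField P (j + 1) N)
    (φ : ScalarField P j N) : ℝ :=
  ∏ y ∈ Λ', B1RT.rtKernel (B1RT.prec a (P.mesh (j + 1)) P.d) (ψ y - avgQ C A φ y)

variable {j : ℕ}

/-- **`t_{a,L,A}(ψ, φ) = [Π_{y∈Λ′} …] · t(Λᶜ; ψ, φ)`**: the kernel (2.5) splits into the blocks inside and outside `Λ′`.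
[cite: Balaban1982Higgs1, (2.5) p.608] -/
theorem rtKernelStep_split (Λ' : Finset (HiggsLattice.Site P (j + 1))) (ψ : ScalarField P (j + 1) N) (φ : ScalarField P j N) :
    rtKernelStep C a A ψ φ = innerKernel C A a j Λ' ψ φ * rtKernelOut C A a j Λ' ψ φ := by
  rw [rtKernelStep, B1RT.blockKernel_eq, innerKernel, rtKernelOut, Finset.prod_mul_prod_compl]

/-- The inner factor is positive (`a > 0`). [cite: Balaban1982Higgs1, (2.6) p.608] -/
theorem innerKernel_pos {a : ℝ} (ha : 0 < a) (Λ' : Finset (HiggsLattice.Site P (j + 1))) (ψ : ScalarField P (j + 1) N)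
    (φ : ScalarField P j N) : 0 < innerKernel C A a j Λ' ψ φ :=
  Finset.prod_pos fun _ _ => B1RT.rtKernel_pos (B1RT.prec_pos ha (P.mesh_pos _) P.d) _

/-- The exterior factor `t(Λᶜ; ψ, φ)` is positive (`a > 0`). [cite: Balaban1982Higgs1, (2.6) p.608] -/
theorem rtKernelOut_pos {a : ℝ} (ha : 0 < a) (Λ' : Finset (HiggsLattice.Site P (j + 1))) (ψ : ScalarField P (j + 1) N)
    (φ : ScalarField P j N) : 0 < rtKernelOut C A a j Λ' ψ φ :=
  Finset.prod_pos fun _ _ => B1RT.rtKernel_pos (B1RT.prec_pos ha (P.mesh_pos _) P.d) _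

/-- `(Q(A)φ)(y)` depends on `φ↾_{B(y)}` only (I (2.7): the sum runs over `x ∈ B(y)`). [cite: Balaban1982Higgs1, (2.7) p.608] -/
theorem avgQ_congr_block {φ φ' : ScalarField P j N} (y : HiggsLattice.Site P (j + 1))
    (h : ∀ x ∈ HiggsLattice.block y, φ x = φ' x) : avgQ C A φ y = avgQ C A φ' y := by
  rw [avgQ_apply, avgQ_apply]
  exact congrArg _ (Finset.sum_congr rfl fun x hx => by rw [h x hx])

/-- A fine site lies in `B(Λ′)` iff its block point lies in `Λ′` — through `x ∈ B(y)`. [cite: Balaban1982Higgs1, (1.18) p.607] -/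
theorem mem_blockSet_of_mem_block {Λ' : Finset (HiggsLattice.Site P (j + 1))} {y : HiggsLattice.Site P (j + 1)}
    {x : HiggsLattice.Site P j} (hx : x ∈ HiggsLattice.block y) : x ∈ blockSet Λ' ↔ y ∈ Λ' := by
  have hb : HiggsLattice.blockOf x = y := by simpa [HiggsLattice.block] using hx
  rw [mem_blockSet, hb]

/-- **The inner factor sees `φ↾_{B(Λ′)}` only.** [cite: Balaban1982Higgs1, (2.5) p.608] -/
theorem innerKernel_congr_field (Λ' : Finset (HiggsLattice.Site P (j + 1))) (ψ : ScalarField P (j + 1) N)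
    {φ φ' : ScalarField P j N} (h : ∀ x ∈ blockSet Λ', φ x = φ' x) :
    innerKernel C A a j Λ' ψ φ = innerKernel C A a j Λ' ψ φ' := by
  unfold innerKernel
  refine Finset.prod_congr rfl fun y hy => ?_
  rw [avgQ_congr_block C A y fun x hx => h x ((mem_blockSet_of_mem_block hx).mpr hy)]

/-- **The exterior factor `t(Λᶜ; ψ, φ)` sees `φ↾_{B(Λ′)ᶜ}` only.** [cite: Balaban1982Higgs2, (2.46) p.567] -/
theorem rtKernelOut_congr_field (Λ' : Finset (HiggsLattice.Site P (j + 1))) (ψ : ScalarField P (j + 1) N)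
    {φ φ' : ScalarField P j N} (h : ∀ x ∉ blockSet Λ', φ x = φ' x) :
    rtKernelOut C A a j Λ' ψ φ = rtKernelOut C A a j Λ' ψ φ' := by
  unfold rtKernelOut
  refine Finset.prod_congr rfl fun y hy => ?_
  rw [avgQ_congr_block C A y fun x hx => h x
    (fun hm => (Finset.mem_compl.mp hy) ((mem_blockSet_of_mem_block hx).mp hm))]

/-- **`A(Γ_{y,x})` for `x ∈ B(y)` depends only on the gauge field on the bonds INSIDE `B^{j+1}(y)`** (the staircase
contour (2.1) from `y` to `x ∈ B(y)` runs inside the block `B^{j+1}(y) ⊂ T_ε`; the geometry of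
`B2Eq273NeumannLocality.stair_bond_inside`, `j + 1 ≤ K` so that the blocks do not wrap). [cite: Balaban1982Higgs1, (2.1)–(2.3) p.608] -/
theorem contourSum_congr_gauge (hj : j + 1 ≤ P.K) {Ak A' : HiggsLattice.VecField P 0} {y : HiggsLattice.Site P (j + 1)}
    (hA : ∀ b : HiggsLattice.PBond P 0, blockIter (j + 1) b.src = y → blockIter (j + 1) b.tgt = y → Ak b = A' b)
    {x : HiggsLattice.Site P j} (hx : x ∈ HiggsLattice.block y) :
    contourSum Ak (toFinest y) (toFinest x) = contourSum A' (toFinest y) (toFinest x) := by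
  have hb : HiggsLattice.blockOf x = y := by simpa [HiggsLattice.block] using hx
  obtain ⟨z, hz⟩ := HiggsFluctMeasurePos.blockIter_surjective (by omega : j ≤ P.K) x
  have hz1 : blockIter (j + 1) z = y := by
    rw [HiggsAveragingCompose.blockIter_succ, hz, hb]
  -- the piece `i = j` of `Γ^{(j+1)}_{y,z}` is `Γ_{y,x}`
  have hΩ : ∀ w w' : HiggsLattice.Site P 0, blockIter (j + 1) w = blockIter (j + 1) w' →
      (w ∈ (Finset.univ.filter fun w => blockIter (j + 1) w = y) ↔
        w' ∈ (Finset.univ.filter fun w => blockIter (j + 1) w = y)) := by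
    intro w w' hww'
    simp [hww']
  have hzΩ : z ∈ (Finset.univ.filter fun w => blockIter (j + 1) w = y) := by simp [hz1]
  rw [← hz, ← hz1]
  unfold contourSum
  refine Finset.sum_congr rfl fun ν _ => ?_
  rw [B2Ineq329PrismHolonomy.corner_eq_cornerN]
  unfold segSum
  refine Finset.sum_congr rfl fun s hs => ?_
  have hin := B2Eq273NeumannLocality.stair_bond_inside hΩ hj hzΩ (Nat.lt_succ_self j) ν (Finset.mem_range.1 hs)
  have h1 : blockIter (j + 1) (shiftN (B2Restr216Lattice.cornerN (toFinest (blockIter (j + 1) z)) (toFinest (blockIter j z)) (ν + 1)) ν s) = y := by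
    simpa using hin.1
  have h2 : blockIter (j + 1) (HiggsLattice.PBond.tgt ⟨shiftN (B2Restr216Lattice.cornerN (toFinest (blockIter (j + 1) z)) (toFinest (blockIter j z)) (ν + 1)) ν s, ν⟩) = y := by
    simpa using hin.2
  exact hA _ h1 h2

/-- Hence **`(Q(Ã)φ)(y) = (Q(A)φ)(y)` whenever `Ã = A` on the bonds inside `B^{j+1}(y)`** — print's situation in (2.45)/(2.46):
the kernel's field `Ã = (1 − θ_k)θ_{k−1}A^{(k−1)} + θ_kA^{(k)}` equals the form's field `A^{(k)}` on `B^{k−1}(Λ₂^{(k−1)})`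
(*"θ_k … is equal to 1 on B^{k−1}(Λ₂^{(k−1)})"*, p. 567) `⊇ B^{k−1}(Λ₅^{(k−1)})`. [cite: Balaban1982Higgs2, (2.45) p.567] -/
theorem avgQ_congr_gauge (hj : j + 1 ≤ P.K) {Ak A' : HiggsLattice.VecField P 0} {y : HiggsLattice.Site P (j + 1)}
    (hA : ∀ b : HiggsLattice.PBond P 0, blockIter (j + 1) b.src = y → blockIter (j + 1) b.tgt = y → Ak b = A' b)
    (φ : ScalarField P j N) : avgQ C Ak φ y = avgQ C A' φ y := by
  rw [avgQ_apply, avgQ_apply]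
  exact congrArg _ (Finset.sum_congr rfl fun x hx => by rw [contourSum_congr_gauge hj hA hx])

/-- **The inner factor with the kernel field `Ã` equals the inner factor with the form field `A`** when the two agree on
the bonds inside `B^{j+1}(Λ′)`. [cite: Balaban1982Higgs2, (2.46) p.567] -/
theorem innerKernel_congr_gauge (hj : j + 1 ≤ P.K) (Λ' : Finset (HiggsLattice.Site P (j + 1)))
    {Ak A' : HiggsLattice.VecField P 0}
    (hA : ∀ b : HiggsLattice.PBond P 0, blockIter (j + 1) b.src ∈ Λ' → blockIter (j + 1) b.tgt ∈ Λ' →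
      blockIter (j + 1) b.src = blockIter (j + 1) b.tgt → Ak b = A' b)
    (ψ : ScalarField P (j + 1) N) (φ : ScalarField P j N) :
    innerKernel C Ak a j Λ' ψ φ = innerKernel C A' a j Λ' ψ φ := by
  unfold innerKernel
  refine Finset.prod_congr rfl fun y hy => ?_
  rw [avgQ_congr_gauge C hj (fun b h1 h2 => hA b (h1 ▸ hy) (h2 ▸ hy) (h1.trans h2.symm)) φ]

end Kernel


/-! ## §4 The MASKED fibre: basic form on `Mφ′` only (`M ⊇ B(Λ′)`), kernel field `Ã` ≠ form field `A` off `B^{j+1}(Λ′)` -/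

section Masked

variable {j : ℕ}

/-- `S(Tφ) = T(Sφ)`: cuts commute. [cite: Balaban1982Higgs2, (2.50) p.568] -/
theorem cutTo_cutTo_comm (S T : Finset (HiggsLattice.Site P j)) (φ : ScalarField P j N) :
    cutTo S (cutTo T φ) = cutTo T (cutTo S φ) := by
  funext x
  by_cases hS : x ∈ S <;> by_cases hT : x ∈ T <;> simp [cutTo, hS, hT]

/-- The cut is continuous in the field. [folklore] [cite: Balaban1982Higgs2, (2.50) p.568] -/
theorem continuous_cutTo (S : Finset (HiggsLattice.Site P j)) : Continuous (cutTo (N := N) S) :=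
  (cutToLin (N := N) S).continuous_of_finiteDimensional

/-- **The masked exterior configuration `(M ∩ Λᶜ)y`**: the exterior coordinates of `M(fieldOfOut Λ y)` — print's
`(Λ₃^{(k−1)} ∩ Λ₅^{(k−1)c})φ′` resp. `(Λ₆^{(k−2)′} ∩ Λ₅^{(k−1)c})A′` in the coordinates of `Λ₅ᶜ`. [cite: Balaban1982Higgs2, (2.46) p.567] -/
noncomputable def maskOut (Λ M : Finset (HiggsLattice.Site P j)) (y : Out (inSet (P := P) N Λ) → ℝ) :
    Out (inSet (P := P) N Λ) → ℝ :=
  resOut (inSet N Λ) (fieldCoord (E N) (HiggsLattice.Site P j) (cutTo M (fieldOfOut Λ y)))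

/-- `fieldOfOut Λ ((M ∩ Λᶜ)y) = M(fieldOfOut Λ y)`. [cite: Balaban1982Higgs2, (2.46) p.567] -/
theorem fieldOfOut_maskOut (Λ M : Finset (HiggsLattice.Site P j)) (y : Out (inSet (P := P) N Λ) → ℝ) :
    fieldOfOut Λ (maskOut Λ M y) = cutTo M (fieldOfOut Λ y) := by
  rw [maskOut, fieldOfOut_resOut, cutTo_cutTo_comm, cutTo_compl_fieldOfOut]

/-- **`M(x on Λ, y on Λᶜ) = (x on Λ, (M ∩ Λᶜ)y on Λᶜ)`** for a mask `M ⊇ Λ`: masking the pair field masks its exterior part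
only. [cite: Balaban1982Higgs2, (2.45) p.567] -/
theorem cutTo_pairField_of_subset {Λ M : Finset (HiggsLattice.Site P j)} (hM : Λ ⊆ M) (x : In (inSet (P := P) N Λ) → ℝ)
    (y : Out (inSet (P := P) N Λ) → ℝ) : cutTo M (pairField Λ x y) = pairField Λ x (maskOut Λ M y) := by
  funext s
  by_cases hs : s ∈ Λ
  · rw [cutTo_of_mem M _ (hM hs), pairField_apply_of_mem Λ x y hs, pairField_apply_of_mem Λ x _ hs]
  · rw [pairField_apply_of_not_mem Λ x _ hs, fieldOfOut_maskOut]
    by_cases hsM : s ∈ M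
    · rw [cutTo_of_mem M _ hsM, cutTo_of_mem M _ hsM, pairField_apply_of_not_mem Λ x y hs]
    · rw [cutTo_of_not_mem M _ hsM, cutTo_of_not_mem M _ hsM]

variable (C : ChargeData N) (Ω : Finset (HiggsLattice.Site P 0)) (A : HiggsLattice.VecField P 0) (msq a : ℝ)

/-- **The masked integrand, pointwise**: for a mask `M ⊇ B(Λ′)` and a kernel field `Ã` agreeing with `A` on the bonds inside
each block `B^{j+1}(y)`, `y ∈ Λ′`,
`t_{a,L,Ã}(ψ, φ′)·e^{−½⟨Mφ′, Δ^{(j)}(Ω,A)Mφ′⟩}·t_A(Λᶜ; ψ, (M∩Λᶜ)y) = t_{a,L,A}(ψ, φ′_M)·e^{−½⟨φ′_M, Δ^{(j)}(Ω,A)φ′_M⟩}·t_Ã(Λᶜ; ψ, y)`,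
`φ′ = (x, y)`, `φ′_M = Mφ′ = (x, (M∩Λᶜ)y)` — the inner kernel factors agree (they see `x` and the field inside `B^{j+1}(Λ′)`
only), the exterior ones are constants of the fibre. [cite: Balaban1982Higgs2, (2.45)–(2.46) p.567] -/
theorem maskedIntegrand_mul_eq (hj : j + 1 ≤ P.K) (Λ' : Finset (HiggsLattice.Site P (j + 1)))
    {M : Finset (HiggsLattice.Site P j)} (hM : blockSet Λ' ⊆ M) {Ak : HiggsLattice.VecField P 0}
    (hAk : ∀ b : HiggsLattice.PBond P 0, blockIter (j + 1) b.src ∈ Λ' → blockIter (j + 1) b.tgt ∈ Λ' →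
      blockIter (j + 1) b.src = blockIter (j + 1) b.tgt → Ak b = A b)
    (ψ : ScalarField P (j + 1) N) (x : In (inSet (P := P) N (blockSet Λ')) → ℝ)
    (y : Out (inSet (P := P) N (blockSet Λ')) → ℝ) :
    rtKernelStep C a Ak ψ (pairField (blockSet Λ') x y)
        * Real.exp (-(1 / 2 : ℝ) * siteInner (cutTo M (pairField (blockSet Λ') x y))
            (deltaKA C Ω A msq a j (cutTo M (pairField (blockSet Λ') x y))))
        * rtKernelOut C A a j Λ' ψ (fieldOfOut (blockSet Λ') (maskOut (blockSet Λ') M y))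
      = rtKernelStep C a A ψ (pairField (blockSet Λ') x (maskOut (blockSet Λ') M y))
        * Real.exp (-(1 / 2 : ℝ) * siteInner (pairField (blockSet Λ') x (maskOut (blockSet Λ') M y))
            (deltaKA C Ω A msq a j (pairField (blockSet Λ') x (maskOut (blockSet Λ') M y))))
        * rtKernelOut C Ak a j Λ' ψ (fieldOfOut (blockSet Λ') y) := by
  rw [cutTo_pairField_of_subset hM, rtKernelStep_split C Ak a Λ', rtKernelStep_split C A a Λ',
    innerKernel_congr_gauge C a hj Λ' hAk,
    innerKernel_congr_field C A a Λ' ψ (φ' := pairField (blockSet Λ') x (maskOut (blockSet Λ') M y))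
      (fun s hs => by rw [pairField_apply_of_mem _ x y hs, pairField_apply_of_mem _ x _ hs]),
    rtKernelOut_congr_field C Ak a Λ' ψ (φ' := fieldOfOut (blockSet Λ') y)
      (fun s hs => pairField_apply_of_not_mem _ x y hs),
    rtKernelOut_congr_field C A a Λ' ψ (φ := pairField (blockSet Λ') x (maskOut (blockSet Λ') M y))
      (φ' := fieldOfOut (blockSet Λ') (maskOut (blockSet Λ') M y)) (fun s hs => pairField_apply_of_not_mem _ x _ hs)]
  ring

/-- **The MASKED fibre of the conditional step, in the kernel form of the print**: for m² > 0, a > 0, L > 1, `j + 1 ≤ K`,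
`Λ = B(Λ′)`, every mask `M ⊇ Λ` and every kernel field `Ã` agreeing with the form's field `A` on the bonds inside the blocks
`B^{j+1}(y)`, `y ∈ Λ′`, at a fixed exterior configuration `y = φ′↾_{Λᶜ}`:
`∫dφ′↾_Λ t^{L^jε}_{a,L,Ã}(ψ, φ′)·exp(−½⟨Mφ′, Δ^{(j),L^jε}(Ω,A)Mφ′⟩)
 = t_Ã(Λᶜ; ψ, y) · exp(condTerms246(ψ, (M∩Λᶜ)y)) · Z^{(j),L^jε}_Λ(Ω,A)`,
i.e. terms 7–10 of (2.46) with the exterior field decorated as `(Λ₃^{(k−1)}∩Λ₅^{(k−1)c})φ′` — EXACTLY AS PRINTED — and the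
restricted kernel `t_{a,L,Ã}(Λ₅ᶜ; φ, φ′)` with the kernel's own field. [cite: Balaban1982Higgs2, (2.46) p.567] -/
theorem fiber_rt_condStep_masked {msq a : ℝ} (hmsq : 0 < msq) (ha : 0 < a) (hL : 1 < (P.L : ℝ)) (hj : j + 1 ≤ P.K)
    (Λ' : Finset (HiggsLattice.Site P (j + 1))) {M : Finset (HiggsLattice.Site P j)} (hM : blockSet Λ' ⊆ M)
    {Ak : HiggsLattice.VecField P 0}
    (hAk : ∀ b : HiggsLattice.PBond P 0, blockIter (j + 1) b.src ∈ Λ' → blockIter (j + 1) b.tgt ∈ Λ' →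
      blockIter (j + 1) b.src = blockIter (j + 1) b.tgt → Ak b = A b)
    (ψ : ScalarField P (j + 1) N) (y : Out (inSet (P := P) N (blockSet Λ')) → ℝ) :
    ∫ x : In (inSet (P := P) N (blockSet Λ')) → ℝ,
        rtKernelStep C a Ak ψ (pairField (blockSet Λ') x y)
          * Real.exp (-(1 / 2 : ℝ) * siteInner (cutTo M (pairField (blockSet Λ') x y))
              (deltaKA C Ω A msq a j (cutTo M (pairField (blockSet Λ') x y))))
      = rtKernelOut C Ak a j Λ' ψ (fieldOfOut (blockSet Λ') y)
          * Real.exp (condTerms246 C Ω A msq a j Λ' ψ (cutTo M (fieldOfOut (blockSet Λ') y)))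
          * zCond252 C Ω A msq a j Λ' := by
  have hR : 0 < rtKernelOut C A a j Λ' ψ (fieldOfOut (blockSet Λ') (maskOut (blockSet Λ') M y)) :=
    rtKernelOut_pos C A ha Λ' ψ _
  apply mul_right_cancel₀ hR.ne'
  rw [← integral_mul_const]
  simp_rw [maskedIntegrand_mul_eq C Ω A msq a hj Λ' hM hAk ψ]
  rw [integral_mul_const, fiber_rt_condStep C Ω A hmsq ha hL (by omega) Λ' ψ, fieldOfOut_maskOut]
  ring

end Masked


/-! ## §5 The masked conditional step INTEGRATED against a nonnegative weight of the exterior field -/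

section Integrated

variable {j : ℕ} (C : ChargeData N) (Ω : Finset (HiggsLattice.Site P 0)) (A : HiggsLattice.VecField P 0) (msq a : ℝ)

/-- The fibre integrand `t_{a,L,A}(ψ,φ′)e^{−½⟨φ′,Δφ′⟩}` at `φ′ = (x, y)` as p15's Gaussian weight × source × a constant.
[cite: Balaban1982Higgs2, (2.45) p.567] -/
theorem kernelGauss_pairField_eq {a : ℝ} (ha : 0 < a) (Λ' : Finset (HiggsLattice.Site P (j + 1)))
    (ψ : ScalarField P (j + 1) N) (x : In (inSet (P := P) N (blockSet Λ')) → ℝ)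
    (y : Out (inSet (P := P) N (blockSet Λ')) → ℝ) :
    rtKernelStep C a A ψ (pairField (blockSet Λ') x y)
        * Real.exp (-(1 / 2 : ℝ) * siteInner (pairField (blockSet Λ') x y)
            (deltaKA C Ω A msq a j (pairField (blockSet Λ') x y)))
      = weight (mainOp (B1RT.prec a (P.mesh (j + 1)) P.d) (kerQ C A j) (matD C A Ω msq a j))
            (glue (inSet N (blockSet Λ')) x y)
          * (source (B1RT.prec a (P.mesh (j + 1)) P.d • (kerQ C A j *ᵥ fieldCoord (E N) (HiggsLattice.Site P (j + 1)) ψ))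
              (glue (inSet N (blockSet Λ')) x y)
            * (B1RT.prec a (P.mesh (j + 1)) P.d / (2 * Real.pi)) ^ ((N : ℝ) / 2 * (Fintype.card (HiggsLattice.Site P (j + 1)) : ℝ))
            * Real.exp (-(1 / 2 : ℝ) * B1RT.prec a (P.mesh (j + 1)) P.d
                * ∑ t, fieldCoord (E N) (HiggsLattice.Site P (j + 1)) ψ t ^ 2)) := by
  rw [rtKernelStep_eq C A j ψ _ ha, mul_assoc, ← exp_stepExp245,
    ← firstExp_eq_stepExp245 C Ω A msq a ψ (pairField (blockSet Λ') x y), fieldCoord_pairField, exp_firstExp]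
  ring

/-- **The fibre integrand is integrable over `φ′↾_Λ`** (a Gaussian with positive definite form, p15's
`integrable_section_const`). [cite: Balaban1982Higgs2, (2.46) p.567] -/
theorem integrable_fiber {msq a : ℝ} (hmsq : 0 < msq) (ha : 0 < a) (hL : 1 < (P.L : ℝ)) (hj : j ≤ P.K)
    (Λ' : Finset (HiggsLattice.Site P (j + 1))) (ψ : ScalarField P (j + 1) N)
    (y : Out (inSet (P := P) N (blockSet Λ')) → ℝ) :
    Integrable fun x : In (inSet (P := P) N (blockSet Λ')) → ℝ =>
      rtKernelStep C a A ψ (pairField (blockSet Λ') x y)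
        * Real.exp (-(1 / 2 : ℝ) * siteInner (pairField (blockSet Λ') x y)
            (deltaKA C Ω A msq a j (pairField (blockSet Λ') x y))) := by
  have hA : (mainOp (B1RT.prec a (P.mesh (j + 1)) P.d) (kerQ C A j) (matD C A Ω msq a j)).PosDef := by
    rw [mainOp_eq_formMat]
    exact formMat_posDef C Ω A hmsq ha hL hj
  simp_rw [kernelGauss_pairField_eq C Ω A msq ha Λ' ψ]
  exact integrable_section_const (inSet N (blockSet Λ')) _ _ hA y _ _

/-- **The MASKED fibre integrand is integrable over `φ′↾_Λ`** (it is a positive multiple of the unmasked one at the masked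
exterior field, `maskedIntegrand_mul_eq`). [cite: Balaban1982Higgs2, (2.46) p.567] -/
theorem integrable_fiber_masked {msq a : ℝ} (hmsq : 0 < msq) (ha : 0 < a) (hL : 1 < (P.L : ℝ)) (hj : j + 1 ≤ P.K)
    (Λ' : Finset (HiggsLattice.Site P (j + 1))) {M : Finset (HiggsLattice.Site P j)} (hM : blockSet Λ' ⊆ M)
    {Ak : HiggsLattice.VecField P 0}
    (hAk : ∀ b : HiggsLattice.PBond P 0, blockIter (j + 1) b.src ∈ Λ' → blockIter (j + 1) b.tgt ∈ Λ' →
      blockIter (j + 1) b.src = blockIter (j + 1) b.tgt → Ak b = A b)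
    (ψ : ScalarField P (j + 1) N) (y : Out (inSet (P := P) N (blockSet Λ')) → ℝ) :
    Integrable fun x : In (inSet (P := P) N (blockSet Λ')) → ℝ =>
      rtKernelStep C a Ak ψ (pairField (blockSet Λ') x y)
        * Real.exp (-(1 / 2 : ℝ) * siteInner (cutTo M (pairField (blockSet Λ') x y))
            (deltaKA C Ω A msq a j (cutTo M (pairField (blockSet Λ') x y)))) := by
  set R : ℝ := rtKernelOut C A a j Λ' ψ (fieldOfOut (blockSet Λ') (maskOut (blockSet Λ') M y)) with hR_def
  have hR : 0 < R := rtKernelOut_pos C A ha Λ' ψ _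
  have h := ((integrable_fiber C Ω A hmsq ha hL (by omega) Λ' ψ (maskOut (blockSet Λ') M y)).mul_const
    (rtKernelOut C Ak a j Λ' ψ (fieldOfOut (blockSet Λ') y))).mul_const R⁻¹
  refine h.congr (Filter.Eventually.of_forall fun x => ?_)
  beta_reduce
  rw [← maskedIntegrand_mul_eq C Ω A msq a hj Λ' hM hAk ψ x y, ← hR_def, mul_assoc, mul_inv_cancel₀ hR.ne', mul_one]

/-- The exterior/new-field part of the integrand is measurable in the field: `φ′ ↦ t_{a,L,Ã}(ψ,φ′)·e^{−½⟨Mφ′,ΔMφ′⟩}·G(Λᶜφ′)`.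
[folklore] [cite: Balaban1982Higgs2, (2.45) p.567] -/
theorem measurable_maskedIntegrand (Λ : Finset (HiggsLattice.Site P j)) (M : Finset (HiggsLattice.Site P j))
    (Ak : HiggsLattice.VecField P 0) {G : ScalarField P j N → ℝ} (hG : Measurable G) (ψ : ScalarField P (j + 1) N) :
    Measurable fun φ : ScalarField P j N =>
      rtKernelStep C a Ak ψ φ
        * (Real.exp (-(1 / 2 : ℝ) * siteInner (cutTo M φ) (deltaKA C Ω A msq a j (cutTo M φ))) * G (cutTo Λᶜ φ)) := by
  have h1 : Continuous fun φ : ScalarField P j N => rtKernelStep C a Ak ψ φ :=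
    HiggsDoubleRT.continuous_rtKernelStep_comp C a continuous_const continuous_const continuous_id
  have h2 : Continuous fun φ : ScalarField P j N =>
      Real.exp (-(1 / 2 : ℝ) * siteInner (cutTo M φ) (deltaKA C Ω A msq a j (cutTo M φ))) :=
    Real.continuous_exp.comp (continuous_const.mul (HiggsFluctMeasure.continuous_siteInner (continuous_cutTo M)
      ((deltaKA C Ω A msq a j).continuous_of_finiteDimensional.comp (continuous_cutTo M))))
  exact h1.measurable.mul (h2.measurable.mul (hG.comp (continuous_cutTo Λᶜ).measurable))

/-- **(2.45) → (2.46) WITH PRINT'S MASK AND PRINT'S KERNEL FIELD, scalar machinery, ON THE CONCRETE CARRIER.**  For m² > 0,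
a > 0, L > 1, `j + 1 ≤ K`, every region `Ω` and form field `A` (↤ `B^{k−1}(Λ₂^{(k−1)})`, `A^{(k),ε}`), coupling `C`, every
`Λ′` (`Λ = B(Λ′)` ↤ `Λ₅^{(k−1)}`), every mask `M ⊇ Λ` (↤ `Λ₃^{(k−1)}`), every kernel field `Ã` agreeing with `A` on the bonds
inside the blocks `B^{j+1}(y)`, `y ∈ Λ′` (↤ `θ_k = 1` there), every new field `ψ` (↤ `φ`) and every NONNEGATIVE measurable
weight `G` of the exterior field (↤ `ζχχρ′ ×` the exponentials of the other terms of (2.45), functions of `Λ₅ᶜφ′`):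
`∫dφ′ t^{L^jε}_{a,L,Ã}(ψ, φ′) · exp(−½⟨Mφ′, Δ^{(j),L^jε}(Ω,A)Mφ′⟩) · G(Λᶜφ′)
 = ∫dφ′↾_{Λᶜ} t_Ã(Λᶜ; ψ, φ′) · exp[−½⟨χ, Δχ⟩ + ½⟨χ, ΔC^{(j)}_Λ(Ω,A)Δχ⟩ − a(L^{j+1}ε)^{−2}⟨χ, ΔC^{(j)}_Λ(Ω,A)Q^*(A)ψ⟩
   − ½⟨ψ, Δ^{(j+1)}_Λ(Ω,A)ψ⟩] · G(φ′↾_{Λᶜ}) · Z^{(j),L^jε}_Λ(Ω,A)`, `χ = (M ∩ Λᶜ)φ′` — terms 7–10 of (2.46) VERBATIM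
(`condTerms246` at the masked exterior field).  No boundedness or convergence hypothesis: both sides are the (finite) integral
when the left integrand is integrable and both Bochner sides are `0` when it is not (`integral_prod_symm_of_nonneg`; the fibres
are Gaussian, `integrable_fiber_masked`); the typer's `rt_condStep` is the case `M = T^{(j)}`, `Ã = A`, `G` bounded.
[cite: Balaban1982Higgs2, (2.46) p.567] -/
theorem rt_condStep_masked {msq a : ℝ} (hmsq : 0 < msq) (ha : 0 < a) (hL : 1 < (P.L : ℝ)) (hj : j + 1 ≤ P.K)
    (Λ' : Finset (HiggsLattice.Site P (j + 1))) {M : Finset (HiggsLattice.Site P j)} (hM : blockSet Λ' ⊆ M)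
    {Ak : HiggsLattice.VecField P 0}
    (hAk : ∀ b : HiggsLattice.PBond P 0, blockIter (j + 1) b.src ∈ Λ' → blockIter (j + 1) b.tgt ∈ Λ' →
      blockIter (j + 1) b.src = blockIter (j + 1) b.tgt → Ak b = A b)
    {G : ScalarField P j N → ℝ} (hG : Measurable G) (hG0 : ∀ φ, 0 ≤ G φ) (ψ : ScalarField P (j + 1) N) :
    ∫ φ : ScalarField P j N, rtKernelStep C a Ak ψ φ
        * (Real.exp (-(1 / 2 : ℝ) * siteInner (cutTo M φ) (deltaKA C Ω A msq a j (cutTo M φ)))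
          * G (cutTo (blockSet Λ')ᶜ φ))
      = (∫ y : Out (inSet (P := P) N (blockSet Λ')) → ℝ,
            rtKernelOut C Ak a j Λ' ψ (fieldOfOut (blockSet Λ') y)
              * (Real.exp (condTerms246 C Ω A msq a j Λ' ψ (cutTo M (fieldOfOut (blockSet Λ') y)))
                * G (fieldOfOut (blockSet Λ') y)))
        * zCond252 C Ω A msq a j Λ' := by
  rw [integral_eq_integral_pairField (blockSet Λ')]
  set F : (In (inSet (P := P) N (blockSet Λ')) → ℝ) × (Out (inSet (P := P) N (blockSet Λ')) → ℝ) → ℝ :=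
    fun q => rtKernelStep C a Ak ψ (pairField (blockSet Λ') q.1 q.2)
      * (Real.exp (-(1 / 2 : ℝ) * siteInner (cutTo M (pairField (blockSet Λ') q.1 q.2))
          (deltaKA C Ω A msq a j (cutTo M (pairField (blockSet Λ') q.1 q.2))))
        * G (cutTo (blockSet Λ')ᶜ (pairField (blockSet Λ') q.1 q.2))) with hF
  have hmeas : Measurable F :=
    (measurable_maskedIntegrand C Ω A msq a (blockSet Λ') M Ak hG ψ).comp (measurable_pairField (blockSet Λ'))
  have h0 : ∀ q, 0 ≤ F q := fun q =>
    mul_nonneg (HiggsDoubleRT.rtKernelStep_nonneg C ha Ak ψ _) (mul_nonneg (Real.exp_pos _).le (hG0 _))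
  have hin : ∀ y : Out (inSet (P := P) N (blockSet Λ')) → ℝ, ∀ x : In (inSet (P := P) N (blockSet Λ')) → ℝ,
      F (x, y) = rtKernelStep C a Ak ψ (pairField (blockSet Λ') x y)
        * Real.exp (-(1 / 2 : ℝ) * siteInner (cutTo M (pairField (blockSet Λ') x y))
            (deltaKA C Ω A msq a j (cutTo M (pairField (blockSet Λ') x y))))
        * G (fieldOfOut (blockSet Λ') y) := by
    intro y x
    simp only [hF, cutTo_compl_pairField]
    ring
  have hfib : ∀ y, Integrable (fun x => F (x, y)) := by
    intro y
    have h := (integrable_fiber_masked C Ω A hmsq ha hL hj Λ' hM hAk ψ y).mul_const (G (fieldOfOut (blockSet Λ') y))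
    refine h.congr (Filter.Eventually.of_forall fun x => ?_)
    beta_reduce
    rw [hin y x]
  have e2 : ∫ q, F q = ∫ y, ∫ x, F (x, y) := integral_prod_symm_of_nonneg hmeas h0 hfib
  rw [e2, ← integral_mul_const]
  refine integral_congr_ae (Filter.Eventually.of_forall fun y => ?_)
  beta_reduce
  simp_rw [hin y]
  rw [integral_mul_const, fiber_rt_condStep_masked C Ω A hmsq ha hL hj Λ' hM hAk ψ y]
  ring

end Integrated

end Literature.MathematicalPhysics.QuantumFieldTheory.Balaban1983to89.B2Eq246MaskedStep
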